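import Mathlib
import Summits.Ventures.PercRepro2.HCov
import Summits.Ventures.PercRepro2.ExploreA3
import Summits.Ventures.PercRepro2.SameClusterAvoid
import Summits.Ventures.PercRepro2.RootLeafUSigns
import Summits.Ventures.PercRepro2.RootLeafUHalf
import Summits.Ventures.PercRepro2.RootLeafUCore
import Summits.Ventures.PercRepro2.RootLeafUYA

/-!
# (G4-u): the general `(YB)` reduced to the three-event inequality `(F)` on `R = {u ↮ a₂, u ↮ c}`
(blind cell PercRepro2, p4 g10; S3 (G4-u), proofs/P4-G10-YBF.md)

The `o ∈ L` half of the second root-leaf coefficient is `T2oL/2 = (YA) + (YB)` (`T2oL_eq_YA_add_YB`),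
`(YA) ≥ 0` is the theorem `YA_nonneg`, and the general
`(YB) = (d0·Z + D)·M + Y_N·B₀ − d0·P(Q,bL)·Y` (`M = P(T,oL,bL)`, `Y_N = P(PD,oL)`, `Y = P(R,oL)`,
`B₀ = P(PD,bL) + P(T′,bL)`, `d0 = P(a₂ ↮ c)`, `Z = P(Q)`, `D = P(PD)`) was the open `L`-half of
`0 ≤ T2` (W1).  Two exact reductions (own exact code, session folder work/code/):

* **the `c ∈ L` regime is free**: `(YB) = (YB_R) + d0·t′·M + b′·(Y_N − d0·Y)` with
  `(YB_R) = (d0·W + D)·M + Y_N·b_N − d0·b_R·Y` (`W = P(R)`, `b_R = P(R,bL)`, `b_N = P(PD,bL)`,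
  `b′ = P(T′,bL)`), the two extra terms non-negative by the tower bound `Y_N ≥ d0·Y`
  (`prob_T_oL_le`);
* **`d0` can be replaced by its Harris bound**: `(YB_R)` is linear in `d0` with coefficient
  `W·M − b_R·Y`; Harris gives `d0·W ≤ D` (`a₂ ↮ c` and `R` decreasing), so when the coefficient is
  negative `(YB_R) ≥ (F)/W` where

  **`(F) := W·(2·D·M + Y_N·b_N) − D·Y·b_R`**, i.e. `2·P_R(X̄)·P_R(X,oL,bL) + P_R(X̄,oL)·P_R(X̄,bL) ≥
  P_R(X̄)·P_R(oL)·P_R(bL)` under `P_R = P(· | R)`, `X = {a₂ ↔ c}` — a statement about the three events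
  `X̄` (decreasing), `oL`, `bL` (increasing) under the cluster law of `u` avoiding `{a₂, c}`, SYMMETRIC
  under `a₂ ↔ c` and `o ↔ b`, and EXACTLY ZERO on the two-path gadget `a₂–o–c, a₂–b–c`.

`YB_nonneg_of_F`: `(F) ≥ 0 ⟹ (YB) ≥ 0`; `T2oL_nonneg_of_F`; `HCov_root_leaf_u_of_F` (the conditional
(G4-u): `(F)` plus the `o ∈ K` half).  `F_of_V2`: `(F)` follows by BHK06 Thm 1.3 (`L` given `R` is
positively associated) from the stronger **`(V2)`**:
`P_R(X̄|oL)·P_R(X̄|bL) + P_R(X̄)·P_R(X|oL,bL) ≥ P_R(X̄)·P_R(X̄|oL,bL)` (cleared by `W·Y·b_R·P(R,oL,bL)`).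
Census (own code, exact): `(F)` 0 / 2,000+ random instances (n ≤ 8, mixed weight palettes incl. 1/1000,
999/1000), `(V2)` 0 / 354; the covariance form `W·(D·M + Y_N·b_N) ≥ D·Y·b_R` is FALSE (exact witness in
proofs/P4-G10-YBF.md), so the factor `2` of `(F)` is needed.
-/

namespace Summit.Ventures.PercRepro2

open UnionCluster CovForm

namespace RootLeafU

namespace YBF

section Algebra

variable {R : Type*} [Field R] [LinearOrder R] [IsStrictOrderedRing R]

/-- The algebra of `(YB) ≥ 0` from `(F)`: `(YB) = (YB_R) + d0·t′·M + b′·(Y_N − d0·Y)`, and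
`(YB_R) = d0·(W·M − b_R·Y) + (D·M + Y_N·b_N)` is non-negative in both signs of the coefficient
(`W·(YB_R) = (F) + (D − d0·W)·(b_R·Y − W·M)` when it is negative). -/
lemma ybr_alg {d0 D t tp YN Yt M bN B1 bp : R} (hd0 : 0 ≤ d0) (hD : 0 ≤ D) (ht : 0 ≤ t)
    (htp : 0 ≤ tp) (hYN : 0 ≤ YN) (hYt : 0 ≤ Yt) (hM : 0 ≤ M) (hbN : 0 ≤ bN) (hB1 : 0 ≤ B1)
    (hbp : 0 ≤ bp) (hMt : M ≤ t) (hYtt : Yt ≤ t) (hB1t : B1 ≤ t) (hYND : YN ≤ D) (hbND : bN ≤ D)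
    (hd0W : d0 * (D + t) ≤ D) (hTow : d0 * (YN + Yt) ≤ YN)
    (hF : D * (YN + Yt) * (bN + B1) ≤ (D + t) * (2 * D * M + YN * bN)) :
    0 ≤ (d0 * (D + t + tp) + D) * M + YN * (bN + bp) - d0 * (bN + B1 + bp) * (YN + Yt) := by
  have hX : 0 ≤ d0 * ((D + t) * M - (bN + B1) * (YN + Yt)) + (D * M + YN * bN) := by
    by_cases h : 0 ≤ (D + t) * M - (bN + B1) * (YN + Yt)
    · have h1 : 0 ≤ d0 * ((D + t) * M - (bN + B1) * (YN + Yt)) := mul_nonneg hd0 h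
      have h2 : 0 ≤ D * M := mul_nonneg hD hM
      have h3 : 0 ≤ YN * bN := mul_nonneg hYN hbN
      linarith
    · have h' : (D + t) * M - (bN + B1) * (YN + Yt) < 0 := not_le.mp h
      have hWX : 0 ≤ (D + t) * (d0 * ((D + t) * M - (bN + B1) * (YN + Yt)) + (D * M + YN * bN)) := by
        have e : (D + t) * (d0 * ((D + t) * M - (bN + B1) * (YN + Yt)) + (D * M + YN * bN)) =
            ((D + t) * (2 * D * M + YN * bN) - D * (YN + Yt) * (bN + B1)) +
              (D - d0 * (D + t)) * ((bN + B1) * (YN + Yt) - (D + t) * M) := by ring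
        rw [e]
        exact add_nonneg (by linarith) (mul_nonneg (by linarith) (by linarith [h']))
      rcases eq_or_lt_of_le (add_nonneg hD ht) with hW0 | hWpos
      · have hD0 : D = 0 := by linarith
        have ht0 : t = 0 := by linarith
        have hM0 : M = 0 := by linarith
        have hYN0 : YN = 0 := by linarith
        have hbN0 : bN = 0 := by linarith
        have hYt0 : Yt = 0 := by linarith
        have hB10 : B1 = 0 := by linarith
        rw [hD0, ht0, hM0, hYN0, hbN0, hYt0, hB10]
        ring_nf
        exact le_refl 0
      · exact (mul_nonneg_iff_of_pos_left hWpos).1 hWX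
  have key : (d0 * (D + t + tp) + D) * M + YN * (bN + bp) - d0 * (bN + B1 + bp) * (YN + Yt) =
      (d0 * ((D + t) * M - (bN + B1) * (YN + Yt)) + (D * M + YN * bN)) + d0 * tp * M +
        bp * (YN - d0 * (YN + Yt)) := by ring
  rw [key]
  have h2 : 0 ≤ d0 * tp * M := mul_nonneg (mul_nonneg hd0 htp) hM
  have h3 : 0 ≤ bp * (YN - d0 * (YN + Yt)) := mul_nonneg hbp (by linarith)
  linarith

/-- The algebra of `(F)` from `(V2)` and BHK: `M_tot·(F) = 2·D·M·(W·M_tot − Y·b_R) +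
[W·M_tot·Y_N·b_N + D·Y·b_R·M − D·Y·b_R·M_N]`. -/
lemma f_of_v2_alg {W D M MN YN bN Y bR : R} (hD : 0 ≤ D) (hM : 0 ≤ M) (hMN : 0 ≤ MN)
    (hYN : 0 ≤ YN) (hbN : 0 ≤ bN) (hY : 0 ≤ Y) (hbR : 0 ≤ bR) (hW : 0 ≤ W)
    (hBHK : Y * bR ≤ W * (M + MN))
    (hV2 : D * Y * bR * MN ≤ W * (M + MN) * YN * bN + D * Y * bR * M) :
    D * Y * bR ≤ W * (2 * D * M + YN * bN) := by
  rcases eq_or_lt_of_le (add_nonneg hM hMN) with hMt0 | hMtpos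
  · have hM0 : M = 0 := by linarith
    have hMN0 : MN = 0 := by linarith
    have hYb : Y * bR = 0 := by
      have h1 : 0 ≤ Y * bR := mul_nonneg hY hbR
      rw [← hMt0, mul_zero] at hBHK
      linarith
    have h2 : 0 ≤ W * (YN * bN) := mul_nonneg hW (mul_nonneg hYN hbN)
    rw [hM0]
    calc D * Y * bR = D * (Y * bR) := by ring
      _ = 0 := by rw [hYb, mul_zero]
      _ ≤ W * (2 * D * 0 + YN * bN) := by
        have : W * (2 * D * 0 + YN * bN) = W * (YN * bN) := by ring
        rw [this]
        exact h2
  · have hprod : 0 ≤ (M + MN) * (W * (2 * D * M + YN * bN) - D * Y * bR) := by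
      have e : (M + MN) * (W * (2 * D * M + YN * bN) - D * Y * bR) =
          2 * D * M * (W * (M + MN) - Y * bR) +
            (W * (M + MN) * YN * bN + D * Y * bR * M - D * Y * bR * MN) := by ring
      rw [e]
      exact add_nonneg (mul_nonneg (mul_nonneg (by linarith) hM) (by linarith)) (by linarith)
    have := (mul_nonneg_iff_of_pos_left hMtpos).1 hprod
    linarith

end Algebra

section Reduction

variable {V : Type*} {E : Type*} [Fintype E] [DecidableEq E] [Fintype V] [DecidableEq V]
  {R : Type*} [Field R] [LinearOrder R] [IsStrictOrderedRing R]

variable (p : E → R) (ends : E → Sym2 V) (o a₂ c b u : V)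

omit [Fintype V] in
/-- `{a₂ ↮ c} ∩ R = PD` in probability (`R = {u ↮ a₂, u ↮ c}`). -/
lemma prob_avoid_inter_R_eq :
    prob p (avoidAll ends a₂ {c} ∩ avoidAll ends u {a₂, c}) = prob p (PDEvent ends u a₂ c) := by
  have h := prob_inter_add_prob_inter_compl p (avoidAll ends u {a₂, c}) (connEvent ends a₂ c)
  have hR : prob p (PDEvent ends u a₂ c) + prob p (TEvent ends u a₂ c) =
      prob p (avoidAll ends u {a₂, c}) := by
    have h' := ISplit.prob_PD_add_T p ends u a₂ c Set.univ
    simpa only [Set.inter_univ] using h'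
  have e1 : avoidAll ends u {a₂, c} ∩ connEvent ends a₂ c = TEvent ends u a₂ c := by
    rw [Set.inter_comm, conn_inter_R]
  have e2 : avoidAll ends a₂ {c} ∩ avoidAll ends u {a₂, c} =
      avoidAll ends u {a₂, c} ∩ (connEvent ends a₂ c)ᶜ := by
    rw [avoidAll_singleton_eq, Set.inter_comm]
  rw [e1] at h
  rw [e2]
  linarith

omit [Fintype V] in
/-- **Harris: `d0·W ≤ D`** (`a₂ ↮ c` and `R` are decreasing events). -/
lemma d0_mul_W_le_D (hp : IsProbVec p) :
    prob p (avoidAll ends a₂ {c}) * prob p (avoidAll ends u {a₂, c}) ≤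
      prob p (PDEvent ends u a₂ c) := by
  have hcl : IsLowerSet (avoidAll ends a₂ {c}) := isLowerSet_avoidAll' ends a₂ {c}
  have hRl : IsLowerSet (avoidAll ends u {a₂, c}) := isLowerSet_avoidAll' ends u {a₂, c}
  have h := prob_mul_prob_le_prob_inter_of_isLowerSet hp hcl hRl
  rw [prob_avoid_inter_R_eq] at h
  exact h

/-- **`(YB) ≥ 0` from `(F)`**: if
`D·Y·b_R ≤ W·(2·D·M + Y_N·b_N)` (`W = P(R)`, `D = P(PD)`, `Y = P(R,oL)`, `b_R = P(R,bL)`,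
`M = P(T,oL,bL)`, `Y_N = P(PD,oL)`, `b_N = P(PD,bL)`), then the general `(YB)` (the second summand of
`T2oL_eq_YA_add_YB`) is non-negative. -/
theorem YB_nonneg_of_F (hp : IsProbVec p)
    (hF : prob p (PDEvent ends u a₂ c) * prob p (avoidAll ends u {a₂, c} ∩ connEvent ends u o) *
        prob p (avoidAll ends u {a₂, c} ∩ connEvent ends u b) ≤
      prob p (avoidAll ends u {a₂, c}) *
        (2 * prob p (PDEvent ends u a₂ c) *
            prob p (TEvent ends u a₂ c ∩ (connEvent ends u o ∩ connEvent ends u b)) +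
          prob p (PDEvent ends u a₂ c ∩ connEvent ends u o) *
            prob p (PDEvent ends u a₂ c ∩ connEvent ends u b))) :
    0 ≤ (prob p (avoidAll ends a₂ {c}) * prob p (avoidAll ends a₂ {u}) + prob p (PDEvent ends u a₂ c)) *
          prob p (TEvent ends u a₂ c ∩ (connEvent ends u o ∩ connEvent ends u b)) +
        prob p (PDEvent ends u a₂ c ∩ connEvent ends u o) *
          (prob p (PDEvent ends u a₂ c ∩ connEvent ends u b) +
            prob p (TEvent ends a₂ u c ∩ connEvent ends u b)) -
        prob p (avoidAll ends a₂ {c}) * prob p (avoidAll ends a₂ {u} ∩ connEvent ends u b) *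
          (prob p (PDEvent ends u a₂ c ∩ connEvent ends u o) +
            prob p (TEvent ends u a₂ c ∩ connEvent ends u o)) := by
  -- the splits `R = PD ⊔ T` (with `oL`, `bL`, `univ`) and `Q = PD ⊔ T ⊔ T′`
  have hW : prob p (avoidAll ends u {a₂, c}) =
      prob p (PDEvent ends u a₂ c) + prob p (TEvent ends u a₂ c) := by
    have h' := ISplit.prob_PD_add_T p ends u a₂ c Set.univ
    simp only [Set.inter_univ] at h'
    exact h'.symm
  have hY := ISplit.prob_PD_add_T p ends u a₂ c (connEvent ends u o)
  have hbR := ISplit.prob_PD_add_T p ends u a₂ c (connEvent ends u b)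
  have hZ := Qsplit_univ p ends u a₂ c
  have hQbL := Qsplit p ends u a₂ c (connEvent ends u b)
  -- Harris `d0·W ≤ D`
  have hd0W := d0_mul_W_le_D p ends a₂ c u hp
  rw [hW] at hd0W
  -- the tower bound `Yt ≤ (1 − d0)·Y`
  have hTow := prob_T_oL_le p ends o a₂ c u hp
  have hd0 : prob p (avoidAll ends a₂ {c}) = 1 - prob p (connEvent ends a₂ c) := by
    rw [avoidAll_singleton_eq, prob_compl]
  have hTow' : prob p (avoidAll ends a₂ {c}) *
      (prob p (PDEvent ends u a₂ c ∩ connEvent ends u o) +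
        prob p (TEvent ends u a₂ c ∩ connEvent ends u o)) ≤
      prob p (PDEvent ends u a₂ c ∩ connEvent ends u o) := by
    rw [hd0]
    rw [← hY] at hTow
    linarith
  -- `(F)` in the split masses
  rw [hW, ← hY, ← hbR] at hF
  -- the small masses are dominated by `t` / `D`
  have hMt : prob p (TEvent ends u a₂ c ∩ (connEvent ends u o ∩ connEvent ends u b)) ≤
      prob p (TEvent ends u a₂ c) := prob_mono hp Set.inter_subset_left
  have hYtt : prob p (TEvent ends u a₂ c ∩ connEvent ends u o) ≤ prob p (TEvent ends u a₂ c) :=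
    prob_mono hp Set.inter_subset_left
  have hB1t : prob p (TEvent ends u a₂ c ∩ connEvent ends u b) ≤ prob p (TEvent ends u a₂ c) :=
    prob_mono hp Set.inter_subset_left
  have hYND : prob p (PDEvent ends u a₂ c ∩ connEvent ends u o) ≤ prob p (PDEvent ends u a₂ c) :=
    prob_mono hp Set.inter_subset_left
  have hbND : prob p (PDEvent ends u a₂ c ∩ connEvent ends u b) ≤ prob p (PDEvent ends u a₂ c) :=
    prob_mono hp Set.inter_subset_left
  rw [hZ, hQbL]
  exact ybr_alg (prob_nonneg hp _) (prob_nonneg hp _) (prob_nonneg hp _) (prob_nonneg hp _)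
    (prob_nonneg hp _) (prob_nonneg hp _) (prob_nonneg hp _) (prob_nonneg hp _) (prob_nonneg hp _)
    (prob_nonneg hp _) hMt hYtt hB1t hYND hbND hd0W hTow' hF

/-- **`0 ≤ T2oL` from `(F)`** (`T2oL/2 = (YA) + (YB)`, `YA_nonneg`, `YB_nonneg_of_F`). -/
theorem T2oL_nonneg_of_F (hp : IsProbVec p)
    (hF : prob p (PDEvent ends u a₂ c) * prob p (avoidAll ends u {a₂, c} ∩ connEvent ends u o) *
        prob p (avoidAll ends u {a₂, c} ∩ connEvent ends u b) ≤
      prob p (avoidAll ends u {a₂, c}) *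
        (2 * prob p (PDEvent ends u a₂ c) *
            prob p (TEvent ends u a₂ c ∩ (connEvent ends u o ∩ connEvent ends u b)) +
          prob p (PDEvent ends u a₂ c ∩ connEvent ends u o) *
            prob p (PDEvent ends u a₂ c ∩ connEvent ends u b))) :
    0 ≤ T2oL p ends o a₂ c b u := by
  rw [T2oL_eq_YA_add_YB]
  have hA := YA_nonneg p ends o a₂ c b u hp
  have hB := YB_nonneg_of_F p ends o a₂ c b u hp hF
  linarith

/-- **(G4-u) from `(F)` and the `o ∈ K` half**: for the root `a₁` a leaf at the unmarked vertex `u`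
(edge `f`), `(F)` and `0 ≤ T2oK` give (HCOV) for the root-leaf instance from (HCOV) for the instance
`a₁ := u`. -/
theorem HCov_root_leaf_u_of_F (hp : IsProbVec p) {f : E} {a₁ : V} (hf : ends f = s(a₁, u))
    (hleaf : ∀ e, a₁ ∈ ends e → e = f) (h1u : a₁ ≠ u) (h12 : a₁ ≠ a₂) (h1c : a₁ ≠ c)
    (h1o : a₁ ≠ o) (h1b : a₁ ≠ b)
    (hF : prob p (PDEvent ends u a₂ c) * prob p (avoidAll ends u {a₂, c} ∩ connEvent ends u o) *
        prob p (avoidAll ends u {a₂, c} ∩ connEvent ends u b) ≤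
      prob p (avoidAll ends u {a₂, c}) *
        (2 * prob p (PDEvent ends u a₂ c) *
            prob p (TEvent ends u a₂ c ∩ (connEvent ends u o ∩ connEvent ends u b)) +
          prob p (PDEvent ends u a₂ c ∩ connEvent ends u o) *
            prob p (PDEvent ends u a₂ c ∩ connEvent ends u b)))
    (hK : 0 ≤ T2oK p ends o a₂ c b u) (h3 : HCov p ends o u a₂ c b) : HCov p ends o a₁ a₂ c b :=
  HCov_root_leaf_u_of p ends hp hf hleaf h1u h12 h1c h1o h1b
    (T2_nonneg_of_halves p ends o a₂ c b u (T2oL_nonneg_of_F p ends o a₂ c b u hp hF) hK) h3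

/-- **BHK06 Thm 1.3 on `R`**: `Y·b_R ≤ W·P(R, oL, bL)` (the cluster of `u` given `u ↮ {a₂, c}` is
positively associated). -/
lemma Y_mul_bR_le (hp : IsProbVec p) :
    prob p (avoidAll ends u {a₂, c} ∩ connEvent ends u o) *
        prob p (avoidAll ends u {a₂, c} ∩ connEvent ends u b) ≤
      prob p (avoidAll ends u {a₂, c}) *
        prob p (avoidAll ends u {a₂, c} ∩ (connEvent ends u o ∩ connEvent ends u b)) := by
  have h := bhk_same_cluster_events_avoid p hp ends u {a₂, c} (𝓤 := {W : Set V | o ∈ W})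
    (𝓥 := {W : Set V | b ∈ W}) (fun _ _ h ho => h ho) (fun _ _ h hb => h hb)
  have e2 : clusterInEvent ends u ({W : Set V | o ∈ W} ∩ {W : Set V | b ∈ W}) =
      clusterInEvent ends u {W : Set V | o ∈ W} ∩ clusterInEvent ends u {W : Set V | b ∈ W} := by
    ext ω; simp [clusterInEvent]
  rw [e2, ExploreA3.clusterInEvent_mem_eq, ExploreA3.clusterInEvent_mem_eq] at h
  have e3 : connEvent ends u o ∩ avoidAll ends u {a₂, c} =
      avoidAll ends u {a₂, c} ∩ connEvent ends u o := Set.inter_comm _ _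
  have e4 : connEvent ends u b ∩ avoidAll ends u {a₂, c} =
      avoidAll ends u {a₂, c} ∩ connEvent ends u b := Set.inter_comm _ _
  have e5 : connEvent ends u o ∩ connEvent ends u b ∩ avoidAll ends u {a₂, c} =
      avoidAll ends u {a₂, c} ∩ (connEvent ends u o ∩ connEvent ends u b) := Set.inter_comm _ _
  rw [e3, e4, e5] at h
  linarith [h]

/-- **`(F)` from `(V2)`**: the cleared form of
`P_R(X̄|oL)·P_R(X̄|bL) + P_R(X̄)·P_R(X|oL,bL) ≥ P_R(X̄)·P_R(X̄|oL,bL)`, i.e.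
`D·Y·b_R·M_N ≤ W·P(R,oL,bL)·Y_N·b_N + D·Y·b_R·M` (`M_N = P(PD,oL,bL)`), gives `(F)` by BHK on `R`. -/
theorem F_of_V2 (hp : IsProbVec p)
    (hV2 : prob p (PDEvent ends u a₂ c) * prob p (avoidAll ends u {a₂, c} ∩ connEvent ends u o) *
        prob p (avoidAll ends u {a₂, c} ∩ connEvent ends u b) *
        prob p (PDEvent ends u a₂ c ∩ (connEvent ends u o ∩ connEvent ends u b)) ≤
      prob p (avoidAll ends u {a₂, c}) *
          prob p (avoidAll ends u {a₂, c} ∩ (connEvent ends u o ∩ connEvent ends u b)) *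
          prob p (PDEvent ends u a₂ c ∩ connEvent ends u o) *
          prob p (PDEvent ends u a₂ c ∩ connEvent ends u b) +
        prob p (PDEvent ends u a₂ c) * prob p (avoidAll ends u {a₂, c} ∩ connEvent ends u o) *
          prob p (avoidAll ends u {a₂, c} ∩ connEvent ends u b) *
          prob p (TEvent ends u a₂ c ∩ (connEvent ends u o ∩ connEvent ends u b))) :
    prob p (PDEvent ends u a₂ c) * prob p (avoidAll ends u {a₂, c} ∩ connEvent ends u o) *
        prob p (avoidAll ends u {a₂, c} ∩ connEvent ends u b) ≤
      prob p (avoidAll ends u {a₂, c}) *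
        (2 * prob p (PDEvent ends u a₂ c) *
            prob p (TEvent ends u a₂ c ∩ (connEvent ends u o ∩ connEvent ends u b)) +
          prob p (PDEvent ends u a₂ c ∩ connEvent ends u o) *
            prob p (PDEvent ends u a₂ c ∩ connEvent ends u b)) := by
  have hBHK := Y_mul_bR_le p ends o a₂ c b u hp
  have hsplit := ISplit.prob_PD_add_T p ends u a₂ c (connEvent ends u o ∩ connEvent ends u b)
  rw [← hsplit] at hBHK hV2
  have hsym : prob p (PDEvent ends u a₂ c ∩ (connEvent ends u o ∩ connEvent ends u b)) +
      prob p (TEvent ends u a₂ c ∩ (connEvent ends u o ∩ connEvent ends u b)) =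
      prob p (TEvent ends u a₂ c ∩ (connEvent ends u o ∩ connEvent ends u b)) +
        prob p (PDEvent ends u a₂ c ∩ (connEvent ends u o ∩ connEvent ends u b)) := add_comm _ _
  rw [hsym] at hBHK hV2
  exact f_of_v2_alg (prob_nonneg hp _) (prob_nonneg hp _) (prob_nonneg hp _) (prob_nonneg hp _)
    (prob_nonneg hp _) (prob_nonneg hp _) (prob_nonneg hp _) (prob_nonneg hp _) hBHK hV2

end Reduction

end YBF

end RootLeafU

end Summit.Ventures.PercRepro2
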